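import Summits.ValiantsHypothesis.ValiantsHypothesis.Theorems.SymPencilPerFourInnerRankFirstForm
import Summits.ValiantsHypothesis.ValiantsHypothesis.Theorems.SymPencilPerFourInnerRankColumnKill

/-!
# Route `SymPencil` — inner rank of the `2 | 2` row split of `per_4`: under (iA) the `y₂`-block of
# the `a`-part has a common image line (FIRST / normal form)
# (`--supports` stmt-ValiantsHypothesis-5674 `SdcSuperquadratic`; (8,8) column, isotropic-kernel
# route, step (B5)(iii) of memo `NOTE-p6g15-5674-IR12-reduction.md` §10 — assembled)

**Theorem** (`firstForm_A₂`).  Let `Σ_r c_r t_r((a,b),(y₂,y₃))² = per (a; b; y₂; y₃)` with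
`|ι| ≤ 11` squares and non-zero weights, and assume (iA): every `A₂(a)` has rank `≤ 1`.  Then
there is ONE vector `v₀ ∈ K^ι` with `A₂(a)y₂ ∈ K v₀` for all `a, y₂`.
(`FirstForm.firstForm_or_column`; the column type is excluded: with (iY₃) by
`ColumnKill.false_of_column_iY₃`, with (iY₂) it is already a common line, and (iiY₂) ∧ (iiY₃) is
excluded by `NotBoth.not_both_fst` on the `y ↔ u`, `y₂ ↔ y₃`-transformed design.)
`firstForm_B₃` is the mirror statement for the `y₃`-block of the `b`-part under (iiB).

So after `…Slots` + `…NotBoth`: WLOG (iA ∧ iiB), and then `A₂(a)y₂ = ψ(a,y₂)·v₀`,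
`B₃(b)y₃ = ψ'(b,y₃)·v₀'` — the NORMAL FORM of memo §3; what is left of the (8,8)-column reduction
is its analysis (pure / peeled) and the pure Gram problem P1 (memo §4–§6).  Honest framing:
conditional reduction machinery; no cell closes; the window `27 ≤ sdc(per_4) ≤ 29`, the crux and
`VP ≠ VNP` are untouched.  No definitions, no named facts. [folklore]
-/

noncomputable section

-- single-conjunct layout: Sub = Summit, duplicated namespace component intended
set_option linter.dupNamespace false

namespace Summit.ValiantsHypothesis.ValiantsHypothesis.Theorems.SymPencilPerFourInnerRankFirstFormA

open Matrix Finset Module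
open Summit.ValiantsHypothesis.ValiantsHypothesis.Theorems.SymPencilPerFourInnerRankTenPairs
open Summit.ValiantsHypothesis.ValiantsHypothesis.Theorems.SymPencilPerFourInnerRankSlots
open Summit.ValiantsHypothesis.ValiantsHypothesis.Theorems.SymPencilPerFourInnerRankRankOne
open Summit.ValiantsHypothesis.ValiantsHypothesis.Theorems.SymPencilPerFourInnerRankNotBoth
open Summit.ValiantsHypothesis.ValiantsHypothesis.Theorems.SymPencilPerFourInnerRankFirstForm
open Summit.ValiantsHypothesis.ValiantsHypothesis.Theorems.SymPencilPerFourInnerRankColumnKill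

variable {K : Type*} [Field K] {ι : Type*} [Fintype ι]

/-- **(iiY₂) and (iiY₃) cannot both hold** (`not_both_fst` on the transformed design
`t*(u, y) = t((y₂ ↔ y₃)(y), u)`). [folklore] -/
theorem not_both_iiY [CharZero K] (c : ι → K)
    (t : ι → (((Fin 4 → K) × (Fin 4 → K)) →ₗ[K] ((Fin 4 → K) × (Fin 4 → K)) →ₗ[K] K))
    (hJ : ∀ a b y₂ y₃ : Fin 4 → K,
      ∑ r, c r * (t r (a, b) (y₂, y₃)) ^ 2 = (Matrix.of ![a, b, y₂, y₃]).permanent)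
    (hY₂ : ∀ (y x x' : Fin 4 → K) (r r' : ι),
      t r (0, x) (y, 0) * t r' (0, x') (y, 0) - t r (0, x') (y, 0) * t r' (0, x) (y, 0) = 0)
    (hY₃ : ∀ (y x x' : Fin 4 → K) (r r' : ι),
      t r (0, x) (0, y) * t r' (0, x') (0, y) - t r (0, x') (0, y) * t r' (0, x) (0, y) = 0) :
    False := by
  have hJT := hJ_transpose c t hJ
  have hJ' := SymPencilPerFourInnerRankSlotAShapes.hJ_yswap c _ hJT
  refine not_both_fst c _ hJ' (fun a x x' r r' => ?_) (fun b x x' r r' => ?_)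
  · simpa using hY₂ a x x' r r'
  · simpa using hY₃ b x x' r r'

/-- **(iA) ⇒ the `y₂`-block of the `a`-part has a common image line.** [folklore] -/
theorem firstForm_A₂ [CharZero K] [DecidableEq ι] (hι : Fintype.card ι ≤ 11)
    (c : ι → K) (hc : ∀ r, c r ≠ 0)
    (t : ι → (((Fin 4 → K) × (Fin 4 → K)) →ₗ[K] ((Fin 4 → K) × (Fin 4 → K)) →ₗ[K] K))
    (hJ : ∀ a b y₂ y₃ : Fin 4 → K,
      ∑ r, c r * (t r (a, b) (y₂, y₃)) ^ 2 = (Matrix.of ![a, b, y₂, y₃]).permanent)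
    (hA : ∀ (a x x' : Fin 4 → K) (r r' : ι),
      t r (a, 0) (x, 0) * t r' (a, 0) (x', 0) - t r (a, 0) (x', 0) * t r' (a, 0) (x, 0) = 0) :
    ∃ v₀ : ι → K, ∀ (a x : Fin 4 → K), ∃ s : K, (fun r => t r (a, 0) (x, 0)) = s • v₀ := by
  rcases firstForm_or_column hι c hc t hJ hA with h | ⟨k, hcols⟩
  · exact h
  -- column type: `A₂(a) x = x_k • A₂(a) e_k`
  have hexp : ∀ (a x : Fin 4 → K) r, t r (a, 0) (x, 0) = x k * t r (a, 0) (Pi.single k 1, 0) := by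
    intro a x r
    have hx : ((x, (0 : Fin 4 → K)) : (Fin 4 → K) × (Fin 4 → K)) =
        ∑ j, x j • ((Pi.single j (1 : K), (0 : Fin 4 → K)) : (Fin 4 → K) × (Fin 4 → K)) := by
      ext j
      · simp [Pi.single_apply, Fin.sum_univ_four]
        fin_cases j <;> simp
      · simp [Prod.snd_sum]
    rw [hx, map_sum, Finset.sum_eq_single k]
    · rw [map_smul, smul_eq_mul]
    · intro j _ hj; rw [map_smul, hcols j hj a r, smul_zero]
    · intro h; exact absurd (Finset.mem_univ k) h
  rcases slotY₃_rank_le_one hι c hc t hJ with hY₃ | hY₃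
  · exact (false_of_column_iY₃ c t hJ k hcols hY₃).elim
  rcases slotY₂_rank_le_one hι c hc t hJ with hY₂ | hY₂
  swap
  · exact (not_both_iiY c t hJ hY₂ hY₃).elim
  -- (iY₂) at `y = e_k`: `a ↦ A₂(a) e_k` has rank ≤ 1, hence a common line
  by_cases hz : ∀ a : Fin 4 → K, (fun r => t r (a, 0) (Pi.single k 1, 0)) = 0
  · refine ⟨0, fun a x => ⟨0, funext fun r => ?_⟩⟩
    have := congr_fun (hz a) r
    simp only [Pi.zero_apply] at this
    rw [hexp, this, mul_zero]; simp
  push Not at hz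
  obtain ⟨a₁, ha₁⟩ := hz
  obtain ⟨r₁, hr₁⟩ : ∃ r, t r (a₁, 0) (Pi.single k 1, 0) ≠ 0 := by
    by_contra h; push Not at h; exact ha₁ (funext fun r => by simpa using h r)
  -- the linear map `a ↦ A₂(a) e_k`
  let N : (Fin 4 → K) →ₗ[K] (ι → K) :=
    (LinearMap.pi fun r => (t r).flip (Pi.single k 1, 0)) ∘ₗ LinearMap.inl K (Fin 4 → K) (Fin 4 → K)
  have hN : ∀ a r, N a r = t r (a, 0) (Pi.single k 1, 0) := fun a r => rfl
  refine ⟨N a₁, fun a x => ?_⟩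
  obtain ⟨s, hs⟩ := exists_smul_of_minors N (fun a a' r r' => by
    simp only [hN]; linear_combination hY₂ (Pi.single k 1) a a' r r') a₁ r₁ (by rw [hN]; exact hr₁) a
  refine ⟨x k * s, funext fun r => ?_⟩
  have := congr_fun hs r
  rw [hN, Pi.smul_apply, smul_eq_mul] at this
  rw [hexp, this, Pi.smul_apply, smul_eq_mul, mul_assoc]

/-- **(iiB) ⇒ the `y₃`-block of the `b`-part has a common image line** (mirror of `firstForm_A₂`
through `a ↔ b`, `y₂ ↔ y₃`). [folklore] -/
theorem firstForm_B₃ [CharZero K] [DecidableEq ι] (hι : Fintype.card ι ≤ 11)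
    (c : ι → K) (hc : ∀ r, c r ≠ 0)
    (t : ι → (((Fin 4 → K) × (Fin 4 → K)) →ₗ[K] ((Fin 4 → K) × (Fin 4 → K)) →ₗ[K] K))
    (hJ : ∀ a b y₂ y₃ : Fin 4 → K,
      ∑ r, c r * (t r (a, b) (y₂, y₃)) ^ 2 = (Matrix.of ![a, b, y₂, y₃]).permanent)
    (hB : ∀ (b x x' : Fin 4 → K) (r r' : ι),
      t r (0, b) (0, x) * t r' (0, b) (0, x') - t r (0, b) (0, x') * t r' (0, b) (0, x) = 0) :
    ∃ v₀ : ι → K, ∀ (b x : Fin 4 → K), ∃ s : K, (fun r => t r (0, b) (0, x)) = s • v₀ := by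
  have hJ' := SymPencilPerFourInnerRankSlotAShapes.hJ_yswap c _ (hJ_swap c t hJ)
  have h := firstForm_A₂ hι c hc _ hJ' (fun a x x' r r' => by simpa using hB a x x' r r')
  simpa using h

end Summit.ValiantsHypothesis.ValiantsHypothesis.Theorems.SymPencilPerFourInnerRankFirstFormA

end
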